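import Literature.MathematicalPhysics.QuantumLattice.StrongExpDecayLGT
import Literature.MathematicalPhysics.QuantumLattice.WilsonLoops
import Literature.MathematicalPhysics.QuantumLattice.LatticeGaugeDLRGibbsProofs
import Literature.Analysis.Convex.SymmetryAdaptedBlockDiagonalization
import HarnessLib

/-!
# Centre symmetry of lattice gauge theory in a slab and Chatterjee's confinement criterion
# (Chatterjee, CMP 385 (2021), Def. 2.1 and Thm. 2.4)

S. Chatterjee, *A probabilistic mechanism for quark confinement*, Commun. Math. Phys. **385**
(2021) 1007–1039, doi:10.1007/s00220-021-04086-y, arXiv:2006.16229 [Chatterjee2021]. Loci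
`pNNNN Ln` = chunk/line of the held corpus text `paper:arxiv-2006.16229` (TeX layer; its theorem
numbers are the journal's). Definition item for cell `ym-beyond` (human ruling D-0035, seat
`ym-beyond-lit`; README P2 «Chatterjee 2020–24 conditional theorems as inputs») and the standing
definition request of route `QuantumFields/YangMills/WeakCouplingMasslessPhase` («`CentreUnbroken ρ β`
(slab centre invariance of all `ymGibbsMeasures ρ β`, Chatterjee 2021 Def. 2.1) … and a vendored
named fact for Chatterjee 2021 Thm 2.2 / Thm 2.4 over `HasStrongExpDecay`»).

## What is printed (verbatim)

* §2.3 [p0006 L7–19]. «fix a positive integer `N` and consider the slab `S := {0,1,…,N} × ℤ^{d−1}`.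
  Let `E(S)` denote the set of positively oriented edges of `S` and `P(S)` denote the set of
  plaquettes in `S`. The slab `S` has two boundaries, namely, the top boundary `{N} × ℤ^{d−1}`, and
  the bottom boundary `{0} × ℤ^{d−1}`. Let `∂E(S)` denote the set of all boundary edges. Let us call
  an element of `G^{∂E(S)}` a boundary condition. Given a boundary condition `δ`, let `Ω(S,δ)` denote
  the set of all `ω ∈ G^{E(S)}` that agree with `δ` on the boundary. The formal Hamiltonian
  `H_{S,δ}(ω) := −∑_{p ∈ P(S)} Re(tr(ω_p))` defines a specification on `Ω(S,δ)` with coupling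
  parameter `β` in the usual way. … Take any element `g₀` in the center of the group `G`. Take any
  `ω ∈ Ω(S,δ)`. For each edge `e` from the boundary `{0} × ℤ^{d−1}` to the layer `{1} × ℤ^{d−1}`,
  replace `ω_e` by `g₀ω_e`. Call the resulting configuration `τ(ω)`. We will refer to `τ` as a center
  transform. Since `g₀` is an element of the center of `G`, it is easy to see that the map `τ` leaves
  `ω_p` invariant for any plaquette `p`, and hence (formally) leaves the Hamiltonian `H_{S,δ}`
  invariant. … we will say that the specification `α` has unbroken center symmetry if every Gibbs
  measure of `α` is invariant under the action of each center transform.»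
* **Definition 2.1** [p0006 L21]. «We will say that the lattice gauge theory on `ℤ^d` defined in
  Subsection 2.1 has unbroken center symmetry if for some `N ≥ 1`, the theory restricted to the slab
  `S = {0,1,…,N} × ℤ^{d−1}`, under any boundary condition, has unbroken center symmetry as defined
  above.»
* **Theorem 2.4** [p0007 L8]. «Consider the lattice gauge theory defined in Subsection 2.1. Suppose
  that it satisfies exponential decay of correlations under arbitrary boundary conditions, according
  to Definition 2.3. Then it has unbroken center symmetry. Moreover, if Wilson loop variables are
  defined using a finite-dimensional irreducible unitary representation `π` that acts nontrivially on
  the center of `G`, then any Gibbs measure for the theory satisfies Wilson's area law (2.3) for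
  rectangular loops.»  Here (2.3) [p0005 L30]: «`|⟨W_ℓ⟩| ≤ C₁ e^{−C₂ area(ℓ)}` for any rectangular
  loop `ℓ`, where `C₁` and `C₂` are positive constants that do not depend on `ℓ`», (2.2) [p0005 L26]:
  «`W_ℓ(ω) := χ_π(ω_{e₁}ω_{e₂}⋯ω_{e_k}) = tr(π(ω_{e₁})π(ω_{e₂})⋯π(ω_{e_k}))`», and [p0006 L31] «the
  condition 'π acts nontrivially on the center of `G`' means that there is at least one element `g₀`
  in the center such that `π(g₀)` is not the identity operator».
* Setting §2.1 [p0005 L7–17]: «Let `n ≥ 1` and `d ≥ 2` be two integers. Let `G` be a closed connected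
  subgroup of `U(n)`», `Ω = G^E`, `H(ω) := −∑_p Re(tr(ω_p))`, «what this actually defines is a
  specification … Any actual probability measure `μ` on `Ω` which has these specified conditional
  distributions is called a Gibbs measure» (Georgii's DLR notion), «we will think of `β` as a fixed
  number and part of the definition» (no sign condition on `β` is printed).

## How it is typed (tree vocabulary only; no notion is re-declared)

* The slab coordinate is the `0`-th coordinate of `Site d = Fin d → ℤ` (`[NeZero d]`); the slab of
  height `n` is `{x | 0 ≤ x 0 ≤ n}`.  `IsSlabInteriorEdge n e` — the edges of `E(S) ∖ ∂E(S)`: the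
  vertical edges `(x, 0)` with `0 ≤ x 0`, `x 0 + 1 ≤ n`, and the horizontal edges `(x, i)`, `i ≠ 0`,
  with `0 < x 0 < n` (the boundary edges are the horizontal edges in the layers `x 0 = 0` and
  `x 0 = n`).  Every plaquette of `ℤ^d` containing an interior edge lies in the slab, so the DLR
  kernel of a finite set `Λ` of interior edges under the tree's Wilson specification
  `ymSpecification ρ β Λ η` (`LatticeGaugeDLR`: product Haar on `Λ` glued with `η`, tilted by
  `exp(−β S_Λ)`, `S_Λ` = sum over the plaquettes touching `Λ`) IS Chatterjee's kernel of the slab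
  theory with boundary condition `δ = η|_{∂E(S)}` (the constant `N·#plaquettes` of the tree's action
  `∑ (N − Re tr ρ(U_p))` cancels in the normalisation, as recorded in `StrongExpDecayLGT`).
* `slabSpecification ρ β n Λ η := ymSpecification ρ β (Λ ∩ interior edges) η`: only interior slab
  variables are resampled; every other link is frozen.  `slabGibbsMeasures ρ β n δ`: the DLR measures
  of `slabSpecification ρ β n` (tree `IsGibbsMeasure`, Georgii Def. 1.23) that are concentrated on
  the configurations equal to `δ` OFF the interior edges — this is `𝒢(α)` for the slab theory with
  boundary condition `δ|_{∂E(S)}` (faithfulness flag: `δ : LGConfig d G` also freezes the links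
  outside the slab, on which no kernel and no slab observable depends; Chatterjee's `Ω(S,δ)` carries
  no such links — the two conventions have the same Gibbs measures up to this inert product factor).
* `centreTransform g₀` — the centre transform `τ`: multiply `U (x, 0)` by `g₀` when `x 0 = 0`
  (the edges from layer `0` to layer `1`), leave every other link.  Proved here:
  `plaquetteHolonomyZd_centreTransform` («`τ` leaves `ω_p` invariant for any plaquette `p`», for
  central `g₀`) and `wilsonBoundaryAction_centreTransform` («hence leaves the Hamiltonian invariant»).
* `SlabCentreUnbroken ρ β n δ` — «the specification `α` has unbroken center symmetry»: every
  `μ ∈ slabGibbsMeasures ρ β n δ` is invariant under `centreTransform g₀` for every central `g₀`.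
  `CentreUnbroken d ρ β` — **Definition 2.1**: `∃ n ≥ 1, ∀ δ, SlabCentreUnbroken ρ β n δ`.
* `chatterjee2021_areaLaw_of_strongExpDecay` — **Theorem 2.4** as a named fact (a `Prop`; the
  printed proof, §§3–9, pp. 8–25, is a coupling/total-variation argument not reproduced here).
  Rendering: «closed connected subgroup of `U(n)`» = a compact Hausdorff second-countable connected
  group `G` with a faithful continuous unitary `ρ : G →* M_N(ℂ)` (the Wilson action uses `ρ`, i.e.
  the defining representation of `ρ(G) ≅ G`); Def. 2.3 = the tree's `HasStrongExpDecayZd d ρ β`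
  (`StrongExpDecayLGT`, with its recorded distance-convention flag); «any Gibbs measure for the
  theory» = `μ ∈ ymGibbsMeasures ρ β`; «finite-dimensional irreducible unitary representation `π`» =
  `π : G →* M_m(ℂ)` continuous, unitary-valued, `SymmetryAdapted.IsIrrep π` (the tree's matrix form
  of Mathlib's `Representation.IsIrreducible`); «rectangular loop» = the tree's `rectWalk x i j R T`
  (`WilsonLoops`; every base point `x`, every plane `i ≠ j`, both orientations, `R, T ≥ 1`),
  `area(ℓ) = R T`; `⟨W_ℓ⟩ = ∫ tr π(hol_ℓ U) dμ(U) ∈ ℂ` with the tree's `walkHolonomy`.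
  The companion **Theorem 2.2** (unbroken centre symmetry alone ⇒ `|⟨W_ℓ⟩| ≤ e^{−V(R)T}` with
  `V(R) → ∞`) is NOT vendored here (one named fact per file, D-0026); available on request.
* `hasAreaLawWith_re_of_norm_integral_trace_le` — bookkeeping, proved: a bound of the printed shape
  `‖⟨W_ℓ⟩‖ ≤ C₁ e^{−C₂ RT}` on the complex loop expectations gives the tree's real-character area law
  `HasAreaLawWith μ (Re ∘ tr ∘ π) (max 1 C₁) C₂` in the `(0,1)` plane (given integrability of the
  bounded loop variables, automatic for continuous `π` on a second-countable `G`).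

* (v2, appended) «it follows that `τ` is a symmetry of the specification `α`» [p0006 L18–19] PROVED:
  `centreTransformEquiv` (τ as a measurable automorphism of the configuration space),
  `slabSpecification_map_centreTransform` — for continuous `ρ`, second-countable `G` and central
  `g₀`, `(γ_Λ(· | η)).map τ = γ_Λ(· | τ η)` for every finite `Λ` (push the tilt through `τ` by the
  proved invariance of `S_Λ`, then left-invariance of the product Haar measure under the coordinate
  multipliers); consequences `IsGibbsMeasure.map_centreTransform` (τ maps DLR measures of the slab
  specification to DLR measures) and `map_centreTransform_mem_slabGibbsMeasures` (for `n ≥ 1` the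
  centre transforms ACT on `slabGibbsMeasures ρ β n δ` — the set over which `SlabCentreUnbroken`
  quantifies is invariant, as the definition of «unbroken» presupposes; Georgii 2011 §5.1).

* (v3, appended) **Theorem 2.2** as a second named fact `chatterjee2021_confinement_of_centreUnbroken`
  (unbroken centre symmetry ALONE ⇒ `|⟨W_ℓ⟩| ≤ e^{−V(R)T}` with `V(R) → ∞` for every Gibbs measure —
  «unbroken center symmetry implies confinement»), requested by the cell's P3 ladder («L4 ⇒ unbroken
  centre symmetry ⇒ L1», ROUTE-P3.md v2 §2) — the rung between the strong gap and confinement.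

## References

* S. Chatterjee, *A probabilistic mechanism for quark confinement*, CMP 385 (2021) 1007–1039,
  arXiv:2006.16229 — §2.1, §2.2 (2.2)–(2.3), §2.3 Def. 2.1, Thm. 2.2, §2.4 Def. 2.3, Thm. 2.4.
  [Chatterjee2021]
* H.-O. Georgii, *Gibbs Measures and Phase Transitions*, 2nd ed. (2011), Def. 1.23 (DLR measures),
  §5.1 (symmetries of specifications). [Georgii2011]
-/

noncomputable section

open MeasureTheory
open Literature.Probability.LatticeModels

namespace Literature.MathematicalPhysics.QuantumLattice

variable {d N : ℕ} {G : Type*} [Group G]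

/-! ### The slab `{0,…,n} × ℤ^{d-1}`: interior edges -/

section Slab

variable [NeZero d]

/-- `e = (x, i)` is an INTERIOR (non-boundary) edge of the slab `S_n = {x | 0 ≤ x 0 ≤ n}`: a
vertical edge `(x, 0)` from layer `x 0` to layer `x 0 + 1 ≤ n`, or a horizontal edge `(x, i)`,
`i ≠ 0`, in a layer `0 < x 0 < n` (the horizontal edges of the layers `0` and `n` are the boundary
edges `∂E(S)`) (Chatterjee 2021 §2.3). [cite: Chatterjee2021, §2.3] -/
def IsSlabInteriorEdge (n : ℕ) (e : ZdEdge d) : Prop :=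
  (e.2 = 0 ∧ 0 ≤ e.1 0 ∧ e.1 0 + 1 ≤ (n : ℤ)) ∨ (e.2 ≠ 0 ∧ 0 < e.1 0 ∧ e.1 0 < (n : ℤ))

/-- Being an interior slab edge is decidable (integer (in)equalities). [folklore] -/
instance IsSlabInteriorEdge.decidable (n : ℕ) : DecidablePred (IsSlabInteriorEdge (d := d) n) :=
  fun e => by unfold IsSlabInteriorEdge; infer_instance

/-- The edges from the bottom boundary `{0} × ℤ^{d-1}` to the layer `{1} × ℤ^{d-1}` — the links
the centre transform acts on — are interior edges of every slab of height `n ≥ 1`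
(Chatterjee 2021 §2.3). [cite: Chatterjee2021, §2.3] -/
theorem isSlabInteriorEdge_of_bottom {n : ℕ} (hn : 1 ≤ n) {e : ZdEdge d} (he : e.2 = 0 ∧ e.1 0 = 0) :
    IsSlabInteriorEdge n e := by
  refine Or.inl ⟨he.1, by rw [he.2], ?_⟩
  rw [he.2]
  exact_mod_cast hn

/-! ### The centre transform -/

/-- The **centre transform** `τ = τ_{g₀}`: multiply the link variable of every edge from the layer
`{0} × ℤ^{d-1}` to the layer `{1} × ℤ^{d-1}` (the vertical edges `(x, 0)` with `x 0 = 0`) on the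
left by `g₀`, and leave all other links unchanged (Chatterjee 2021 §2.3: «replace `ω_e` by
`g₀ω_e`»). Meaningful for `g₀` in the centre of `G`. [cite: Chatterjee2021, §2.3] -/
def centreTransform (g₀ : G) (U : LGConfig d G) : LGConfig d G :=
  fun e => if e.2 = 0 ∧ e.1 0 = 0 then g₀ * U e else U e

/-- The centre transform on a bottom vertical edge. [cite: Chatterjee2021, §2.3] -/
theorem centreTransform_apply_of_pos (g₀ : G) (U : LGConfig d G) {e : ZdEdge d}
    (he : e.2 = 0 ∧ e.1 0 = 0) : centreTransform g₀ U e = g₀ * U e := by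
  simp [centreTransform, he]

/-- The centre transform off the bottom vertical edges. [cite: Chatterjee2021, §2.3] -/
theorem centreTransform_apply_of_neg (g₀ : G) (U : LGConfig d G) {e : ZdEdge d}
    (he : ¬ (e.2 = 0 ∧ e.1 0 = 0)) : centreTransform g₀ U e = U e := by
  simp [centreTransform, he]

/-- `τ_1 = id`: the centre transforms form a group action, trivial at the identity (Chatterjee
2021 §2.3, the centre transform; Georgii 2011 §5.1, transformation groups acting on
configurations). [cite: Chatterjee2021, §2.3 (centre transform)] -/
@[simp] theorem centreTransform_one : centreTransform (d := d) (1 : G) = id := by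
  funext U e
  simp [centreTransform]

/-- `τ_{g h} = τ_g ∘ τ_h`: the centre transforms form a left action of `G` (in particular of
`Z(G)`) on configurations (Chatterjee 2021 §2.3; Georgii 2011 §5.1). [cite: Chatterjee2021, §2.3 (centre transform)] -/
theorem centreTransform_mul (g h : G) :
    centreTransform (d := d) (g * h) = centreTransform g ∘ centreTransform h := by
  funext U e
  by_cases he : e.2 = 0 ∧ e.1 0 = 0
  · simp [centreTransform, he, mul_assoc]
  · simp [centreTransform, he]

/-- `τ_{g⁻¹} ∘ τ_g = id`: each centre transform is a bijection of the configuration space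
(Chatterjee 2021 §2.3). [cite: Chatterjee2021, §2.3 (centre transform)] -/
theorem centreTransform_inv_comp (g : G) :
    centreTransform (d := d) g⁻¹ ∘ centreTransform g = id := by
  rw [← centreTransform_mul, inv_mul_cancel, centreTransform_one]

/-- The centre transform is measurable (coordinatewise left multiplication), so that the push-forward
`τ_* μ` in «invariant under the action of each center transform» is the image measure (Chatterjee
2021 §2.3; Georgii 2011 §5.1, measurable transformations). [cite: Chatterjee2021, §2.3 (centre transform)] -/
theorem measurable_centreTransform [MeasurableSpace G] [MeasurableMul G] (g₀ : G) :
    Measurable (centreTransform (d := d) g₀) := by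
  refine measurable_pi_lambda _ fun e => ?_
  by_cases he : e.2 = 0 ∧ e.1 0 = 0
  · simp only [centreTransform, he, and_self, if_true]
    have h1 : Measurable (fun U : LGConfig d G => U e) := measurable_pi_apply e
    exact h1.const_mul g₀
  · simp only [centreTransform, he, if_false]
    exact measurable_pi_apply e

/-- The multiplier of the centre transform at an edge: `g₀` on the bottom vertical edges, `1`
elsewhere; `τ U e = w e * U e` («replace `ω_e` by `g₀ω_e`», Chatterjee 2021 §2.3). [cite: Chatterjee2021, §2.3 (centre transform)] -/
theorem centreTransform_eq_mul (g₀ : G) (U : LGConfig d G) (e : ZdEdge d) :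
    centreTransform g₀ U e = (if e.2 = 0 ∧ e.1 0 = 0 then g₀ else 1) * U e := by
  by_cases he : e.2 = 0 ∧ e.1 0 = 0 <;> simp [centreTransform, he]

/-- A central multiplier commutes past anything: for `c ∈ Z(G)`, `c * a = a * c`. [folklore] -/
private theorem center_comm {c : G} (hc : c ∈ Subgroup.center G) (a : G) : c * a = a * c :=
  ((Subgroup.mem_center_iff.1 hc) a).symm

/-- Two factors with central prefactors: `(c a) (c' b) = (c c') (a b)` for central `c'`. [folklore] -/
private theorem center_mul_mul (c : G) {c' : G} (hc' : c' ∈ Subgroup.center G) (a b : G) :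
    (c * a) * (c' * b) = (c * c') * (a * b) := by
  rw [mul_assoc c a, ← mul_assoc a c', ← center_comm hc' a, mul_assoc c', ← mul_assoc c]

/-- The inverse of a factor with a central prefactor: `(c a)⁻¹ = c⁻¹ a⁻¹`. [folklore] -/
private theorem center_mul_inv {c : G} (hc : c ∈ Subgroup.center G) (a : G) :
    (c * a)⁻¹ = c⁻¹ * a⁻¹ := by
  rw [mul_inv_rev]
  exact (center_comm (Subgroup.inv_mem _ hc) a⁻¹).symm

/-- «Since `g₀` is an element of the center of `G`, … the map `τ` leaves `ω_p` invariant for any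
plaquette `p`» (Chatterjee 2021 §2.3): for central `g₀` every plaquette holonomy of `ℤ^d` is
unchanged by the centre transform (the two bottom vertical edges of a plaquette between the layers
`0` and `1` contribute `g₀` and `g₀⁻¹`, which cancel by centrality; no other plaquette is touched).
[cite: Chatterjee2021, §2.3] -/
theorem plaquetteHolonomyZd_centreTransform {g₀ : G} (hg : g₀ ∈ Subgroup.center G)
    (U : LGConfig d G) (x : Site d) (i j : Fin d) :
    plaquetteHolonomyZd (centreTransform g₀ U) x i j = plaquetteHolonomyZd U x i j := by
  -- the four multipliers
  simp only [plaquetteHolonomyZd, centreTransform_eq_mul]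
  set w₁ : G := if ((x, i) : ZdEdge d).2 = 0 ∧ ((x, i) : ZdEdge d).1 0 = 0 then g₀ else 1 with hw₁
  set w₂ : G := if ((x + Pi.single i 1, j) : ZdEdge d).2 = 0 ∧
      ((x + Pi.single i 1, j) : ZdEdge d).1 0 = 0 then g₀ else 1 with hw₂
  set w₃ : G := if ((x + Pi.single j 1, i) : ZdEdge d).2 = 0 ∧
      ((x + Pi.single j 1, i) : ZdEdge d).1 0 = 0 then g₀ else 1 with hw₃
  set w₄ : G := if ((x, j) : ZdEdge d).2 = 0 ∧ ((x, j) : ZdEdge d).1 0 = 0 then g₀ else 1 with hw₄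
  -- all multipliers are central
  have hc : ∀ (P : Prop) [Decidable P], (if P then g₀ else (1 : G)) ∈ Subgroup.center G := by
    intro P _
    split
    · exact hg
    · exact Subgroup.one_mem _
  have hc₂ : w₂ ∈ Subgroup.center G := hc _
  have hc₃ : w₃ ∈ Subgroup.center G := hc _
  have hc₄ : w₄ ∈ Subgroup.center G := hc _
  -- the multipliers balance: `w₁ w₂ = w₄ w₃` (only the plaquettes between the layers `0` and `1`
  -- in a plane containing the slab direction carry multipliers, one `g₀` on each vertical edge)
  have hbal : w₁ * w₂ = w₄ * w₃ := by
    by_cases hi : i = 0 <;> by_cases hj : j = 0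
    · subst hi; subst hj; simp [hw₁, hw₂, hw₃, hw₄]
    · subst hi; simp [hw₁, hw₂, hw₃, hw₄, hj, Ne.symm hj]
    · subst hj; simp [hw₁, hw₂, hw₃, hw₄, hi, Ne.symm hi]
    · simp [hw₁, hw₂, hw₃, hw₄, hi, hj]
  -- pull the central multipliers out and cancel them
  rw [center_mul_inv hc₃, center_mul_inv hc₄, center_mul_mul w₁ hc₂,
    center_mul_mul (w₁ * w₂) (Subgroup.inv_mem _ hc₃), center_mul_mul (w₁ * w₂ * w₃⁻¹) (Subgroup.inv_mem _ hc₄),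
    hbal, mul_inv_cancel_right, mul_inv_cancel, one_mul]

/-- «… and hence (formally) leaves the Hamiltonian `H_{S,δ}` invariant» (Chatterjee 2021 §2.3):
the boundary Wilson action `S_Λ` of every finite edge set is invariant under the centre transform
by a central element. [cite: Chatterjee2021, §2.3] -/
theorem wilsonBoundaryAction_centreTransform (ρ : G →* Matrix (Fin N) (Fin N) ℂ) {g₀ : G}
    (hg : g₀ ∈ Subgroup.center G) (Λ : Finset (ZdEdge d)) (U : LGConfig d G) :
    wilsonBoundaryAction ρ Λ (centreTransform g₀ U) = wilsonBoundaryAction ρ Λ U := by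
  simp only [wilsonBoundaryAction, plaquetteObs, plaquetteHolonomyZd_centreTransform hg]

/-! ### The slab specification, its Gibbs measures, unbroken centre symmetry -/

variable (ρ : G →* Matrix (Fin N) (Fin N) ℂ)
variable [TopologicalSpace G] [IsTopologicalGroup G] [CompactSpace G] [MeasurableSpace G]
  [BorelSpace G]

/-- The specification of «the lattice gauge theory on `S` with boundary condition» (Chatterjee
2021 §2.3): for a finite edge set `Λ`, resample the INTERIOR slab edges of `Λ` with the Wilson DLR
kernel `ymSpecification ρ β` and keep every other link (boundary edges of the slab, edges outside
the slab) frozen to the outside configuration `η`. Every plaquette touching an interior edge lies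
in the slab, so for `Λ ⊆` interior edges this is exactly the kernel defined by
`H_{S,δ} = −∑_{p ∈ P(S)} Re tr(ω_p)` with `δ = η|_{∂E(S)}`. [cite: Chatterjee2021, §2.3] -/
def slabSpecification (β : ℝ) (n : ℕ) : Specification (ZdEdge d) G :=
  fun Λ η => ymSpecification ρ β (Λ.filter (IsSlabInteriorEdge (d := d) n)) η

/-- The Gibbs measures «of the specification `α`» of the slab theory of height `n` with boundary
condition `δ`: DLR measures of `slabSpecification ρ β n` (Georgii Def. 1.23, tree
`IsGibbsMeasure`) concentrated on the configurations that agree with `δ` off the interior slab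
edges (`δ` prescribes the boundary links `∂E(S)`; its values outside the slab are inert).
[cite: Chatterjee2021, §2.3] -/
def slabGibbsMeasures (β : ℝ) (n : ℕ) (δ : LGConfig d G) : Set (Measure (LGConfig d G)) :=
  {μ | IsGibbsMeasure (slabSpecification ρ β n) μ ∧ ∀ᵐ U ∂μ, ∀ e, ¬ IsSlabInteriorEdge n e → U e = δ e}

/-- Membership in `slabGibbsMeasures` unfolded. [cite: Chatterjee2021, §2.3] -/
theorem mem_slabGibbsMeasures_iff (β : ℝ) (n : ℕ) (δ : LGConfig d G) (μ : Measure (LGConfig d G)) :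
    μ ∈ slabGibbsMeasures ρ β n δ ↔
      IsGibbsMeasure (slabSpecification ρ β n) μ ∧ ∀ᵐ U ∂μ, ∀ e, ¬ IsSlabInteriorEdge n e → U e = δ e :=
  Iff.rfl

/-- «The specification `α` has unbroken center symmetry if every Gibbs measure of `α` is invariant
under the action of each center transform» — the slab theory of height `n` with boundary condition
`δ` (Chatterjee 2021 §2.3). [cite: Chatterjee2021, §2.3] -/
def SlabCentreUnbroken (β : ℝ) (n : ℕ) (δ : LGConfig d G) : Prop :=
  ∀ g₀ ∈ Subgroup.center G, ∀ μ ∈ slabGibbsMeasures ρ β n δ, μ.map (centreTransform g₀) = μ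

/-- **Unbroken centre symmetry** (Chatterjee 2021, **Definition 2.1**): «the lattice gauge theory
on `ℤ^d` … has unbroken center symmetry if for some `N ≥ 1`, the theory restricted to the slab
`S = {0,1,…,N} × ℤ^{d−1}`, under any boundary condition, has unbroken center symmetry».
[cite: Chatterjee2021, Def. 2.1] -/
def CentreUnbroken (d : ℕ) [NeZero d] (ρ : G →* Matrix (Fin N) (Fin N) ℂ) (β : ℝ) : Prop :=
  ∃ n : ℕ, 1 ≤ n ∧ ∀ δ : LGConfig d G, SlabCentreUnbroken ρ β n δ

/-- `CentreUnbroken` unfolded. [cite: Chatterjee2021, Def. 2.1] -/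
theorem centreUnbroken_iff (β : ℝ) :
    CentreUnbroken d ρ β ↔ ∃ n : ℕ, 1 ≤ n ∧ ∀ (δ : LGConfig d G), ∀ g₀ ∈ Subgroup.center G,
      ∀ μ ∈ slabGibbsMeasures ρ β n δ, μ.map (centreTransform g₀) = μ :=
  Iff.rfl

/-- For a group with trivial centre every slab theory has unbroken centre symmetry (the only
centre transform is the identity) — the definition carries content only through `Z(G)`:
Chatterjee 2021 §2.3, after Thm. 2.2, «This requires, in particular, that the center of `G` is
nontrivial. Indeed, it is believed that if the center of the gauge group is trivial, such as in
`SO(3)` theory, then quarks may not confine at weak coupling». [cite: Chatterjee2021, §2.3 (remark after Thm. 2.2)] -/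
theorem slabCentreUnbroken_of_center_eq_bot (h : Subgroup.center G = ⊥) (β : ℝ) (n : ℕ)
    (δ : LGConfig d G) : SlabCentreUnbroken ρ β n δ := by
  intro g₀ hg μ _
  rw [h, Subgroup.mem_bot] at hg
  subst hg
  rw [centreTransform_one (d := d) (G := G), Measure.map_id]

end Slab

/-! ### Chatterjee's Theorem 2.4 (named fact) -/

/-- **Chatterjee 2021, Theorem 2.4** («exponential decay of correlations under arbitrary boundary
conditions implies unbroken center symmetry, hence Wilson's area law»), verbatim: «Consider the
lattice gauge theory defined in Subsection 2.1. Suppose that it satisfies exponential decay of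
correlations under arbitrary boundary conditions, according to Definition 2.3. Then it has unbroken
center symmetry. Moreover, if Wilson loop variables are defined using a finite-dimensional
irreducible unitary representation `π` that acts nontrivially on the center of `G`, then any Gibbs
measure for the theory satisfies Wilson's area law (2.3) for rectangular loops», i.e.
«`|⟨W_ℓ⟩| ≤ C₁ e^{−C₂ area(ℓ)}` … where `C₁` and `C₂` are positive constants that do not depend on
`ℓ`», `W_ℓ = tr(π(ω_{e₁})⋯π(ω_{e_k}))`. Setting of §2.1: `d ≥ 2`, `G` a closed connected subgroup
of `U(n)` (here: compact Hausdorff second-countable connected `G` with a faithful continuous unitary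
`ρ`, the Wilson action `β ∑_p Re tr ρ(U_p)` being that of the defining representation of
`ρ(G) ≅ G`), `β ∈ ℝ` fixed; Def. 2.3 = `HasStrongExpDecayZd d ρ β`; Gibbs measures = DLR measures
`ymGibbsMeasures ρ β`; rectangular loops = `rectWalk x i j R T`, `i ≠ j`, `R, T ≥ 1`,
`area = R T`. Hypothesis schema of the printed theorem (proof: op. cit. §§3–9), not proved here.
[cite: Chatterjee2021, Thm. 2.4] -/
def chatterjee2021_areaLaw_of_strongExpDecay : Prop :=
  ∀ (d : ℕ) [NeZero d], 2 ≤ d →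
    ∀ (G : Type) [Group G] [TopologicalSpace G] [IsTopologicalGroup G] [CompactSpace G] [T2Space G]
      [SecondCountableTopology G] [ConnectedSpace G] [MeasurableSpace G] [BorelSpace G]
      (N : ℕ) (ρ : G →* Matrix (Fin N) (Fin N) ℂ),
      Continuous ρ → Function.Injective ρ → (∀ g, ρ g ∈ Matrix.unitaryGroup (Fin N) ℂ) →
    ∀ (β : ℝ), HasStrongExpDecayZd d ρ β →
      CentreUnbroken d ρ β ∧
        ∀ (m : ℕ) (π : G →* Matrix (Fin m) (Fin m) ℂ),
          Continuous π → (∀ g, π g ∈ Matrix.unitaryGroup (Fin m) ℂ) →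
          Literature.Analysis.Convex.SymmetryAdapted.IsIrrep π →
          (∃ g₀ ∈ Subgroup.center G, π g₀ ≠ 1) →
        ∀ μ ∈ ymGibbsMeasures ρ β,
          ∃ C₁ C₂ : ℝ, 0 < C₁ ∧ 0 < C₂ ∧
            ∀ (x : Site d) (i j : Fin d), i ≠ j → ∀ (R T : ℕ), 1 ≤ R → 1 ≤ T →
              ‖∫ U, (π (walkHolonomy U (rectWalk x i j R T))).trace ∂μ‖ ≤
                C₁ * Real.exp (-(C₂ * (R * T)))

/-! ### Chatterjee's Theorem 2.2 (named fact) -/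

/-- **Chatterjee 2021, Theorem 2.2** («unbroken center symmetry implies confinement»), verbatim [p0006
L29]: «Suppose that the lattice gauge theory defined in Subsection 2.1 has unbroken center symmetry in
the sense of Definition 2.1. Let `π` be a finite-dimensional irreducible unitary representation of `G`
that acts nontrivially on the center of `G`. Let `W_ℓ` denote the Wilson loop variable for a loop `ℓ`,
defined using the representation `π` as in equation (2.2). Then there is a function `V : ℤ₊ → ℝ`,
satisfying `V(R) → ∞` as `R → ∞`, such that for any rectangular loop `ℓ` with side-lengths `R ≤ T`,
and for any Gibbs measure of our lattice gauge theory on `ℤ^d`, we have `|⟨W_ℓ⟩| ≤ e^{−V(R) T}`.»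
Setting and renderings as in `chatterjee2021_areaLaw_of_strongExpDecay` (§2.1: `d ≥ 2`, `G` a closed
connected subgroup of `U(n)` = compact Hausdorff second-countable connected `G` with a faithful continuous
unitary `ρ`; unbroken centre symmetry = `CentreUnbroken d ρ β` (Def. 2.1); Gibbs measures =
`ymGibbsMeasures ρ β`; rectangular loop with sides `R ≤ T` = `rectWalk x i j R T`, `1 ≤ R ≤ T`, any base
point and plane; `⟨W_ℓ⟩ = ∫ tr π(hol_ℓ) dμ ∈ ℂ`); `V` depends on the theory and `π` only, not on the
Gibbs measure (as printed). Hypothesis schema of the printed theorem (proof: op. cit. §3), not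
proved here. [cite: Chatterjee2021, Thm. 2.2] -/
def chatterjee2021_confinement_of_centreUnbroken : Prop :=
  ∀ (d : ℕ) [NeZero d], 2 ≤ d →
    ∀ (G : Type) [Group G] [TopologicalSpace G] [IsTopologicalGroup G] [CompactSpace G] [T2Space G]
      [SecondCountableTopology G] [ConnectedSpace G] [MeasurableSpace G] [BorelSpace G]
      (N : ℕ) (ρ : G →* Matrix (Fin N) (Fin N) ℂ),
      Continuous ρ → Function.Injective ρ → (∀ g, ρ g ∈ Matrix.unitaryGroup (Fin N) ℂ) →
    ∀ (β : ℝ), CentreUnbroken d ρ β →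
      ∀ (m : ℕ) (π : G →* Matrix (Fin m) (Fin m) ℂ),
        Continuous π → (∀ g, π g ∈ Matrix.unitaryGroup (Fin m) ℂ) →
        Literature.Analysis.Convex.SymmetryAdapted.IsIrrep π →
        (∃ g₀ ∈ Subgroup.center G, π g₀ ≠ 1) →
      ∃ V : ℕ → ℝ, Filter.Tendsto V Filter.atTop Filter.atTop ∧
        ∀ μ ∈ ymGibbsMeasures ρ β,
          ∀ (x : Site d) (i j : Fin d), i ≠ j → ∀ (R T : ℕ), 1 ≤ R → R ≤ T →
            ‖∫ U, (π (walkHolonomy U (rectWalk x i j R T))).trace ∂μ‖ ≤ Real.exp (-(V R * T))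

/-! ### Bookkeeping: from the printed complex bound to the tree's real-character area law -/

section Bookkeeping

variable {m : ℕ} [MeasurableSpace G] [NeZero d]

/-- A bound of the printed shape `‖∫ tr π(hol_{R×T}) dμ‖ ≤ C₁ e^{−C₂ RT}` on the complex
rectangular loop expectations in the `(0,1)` plane gives the tree's area law `HasAreaLawWith μ χ
(max 1 C₁) C₂` for the real character `χ = Re ∘ tr ∘ π` (`|Re z| ≤ ‖z‖`, `∫ Re = Re ∫` for
integrable loop variables, and `C₁ ≤ (max 1 C₁)^{2(R+T)}`): Chatterjee's area law (2.3),
«`|⟨W_ℓ⟩| ≤ C₁ e^{−C₂ area(ℓ)}`», in the tree's `WilsonLoops` currency. [cite: Chatterjee2021, §2.2 (2.3)] -/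
theorem hasAreaLawWith_re_of_norm_integral_trace_le (π : G →* Matrix (Fin m) (Fin m) ℂ)
    (μ : Measure (LGConfig d G)) {C₁ C₂ : ℝ}
    (hint : ∀ R T : ℕ, Integrable (fun U => (π (walkHolonomy U (rectWalk 0 0 1 R T))).trace) μ)
    (h : ∀ R T : ℕ, 1 ≤ R → 1 ≤ T →
      ‖∫ U, (π (walkHolonomy U (rectWalk 0 0 1 R T))).trace ∂μ‖ ≤ C₁ * Real.exp (-(C₂ * (R * T)))) :
    HasAreaLawWith μ (fun g => (π g).trace.re) (max 1 C₁) C₂ := by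
  intro R T hR hT
  have hre : rectExpectation μ (fun g => (π g).trace.re) 0 1 R T =
      (∫ U, (π (walkHolonomy U (rectWalk 0 0 1 R T))).trace ∂μ).re := by
    simp only [rectExpectation, loopExpectation, wilsonLoopObs]
    simpa only [RCLike.re_to_complex] using integral_re (hint R T)
  rw [hre]
  calc |(∫ U, (π (walkHolonomy U (rectWalk 0 0 1 R T))).trace ∂μ).re|
      ≤ ‖∫ U, (π (walkHolonomy U (rectWalk 0 0 1 R T))).trace ∂μ‖ := Complex.abs_re_le_norm _
    _ ≤ C₁ * Real.exp (-(C₂ * (R * T))) := h R T hR hT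
    _ ≤ (max 1 C₁) ^ (2 * (R + T)) * Real.exp (-C₂ * R * T) := by
        have hexp : Real.exp (-(C₂ * (R * T))) = Real.exp (-C₂ * R * T) := by ring_nf
        rw [hexp]
        refine mul_le_mul_of_nonneg_right ?_ (Real.exp_pos _).le
        calc C₁ ≤ max 1 C₁ := le_max_right _ _
          _ ≤ (max 1 C₁) ^ (2 * (R + T)) := le_self_pow₀ (le_max_left _ _) (by omega)

end Bookkeeping

/-! ### «τ is a symmetry of the specification α» (Chatterjee 2021 §2.3), proved -/

section Symmetry

variable [NeZero d]

/-- The centre transform as a measurable automorphism of the configuration space, with inverse the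
centre transform by `g₀⁻¹` (Chatterjee 2021 §2.3; Georgii 2011 §5.1, transformations of the
configuration space). [cite: Chatterjee2021, §2.3 (centre transform)] -/
def centreTransformEquiv [MeasurableSpace G] [MeasurableMul G] (g₀ : G) :
    LGConfig d G ≃ᵐ LGConfig d G where
  toFun := centreTransform g₀
  invFun := centreTransform g₀⁻¹
  left_inv U := by
    change (centreTransform g₀⁻¹ ∘ centreTransform g₀) U = U
    rw [centreTransform_inv_comp]; rfl
  right_inv U := by
    change (centreTransform g₀ ∘ centreTransform g₀⁻¹) U = U
    have h := centreTransform_inv_comp (d := d) g₀⁻¹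
    rw [inv_inv] at h
    rw [h]; rfl
  measurable_toFun := measurable_centreTransform g₀
  measurable_invFun := measurable_centreTransform g₀⁻¹

/-- `centreTransformEquiv g₀` acts as `centreTransform g₀`. [cite: Chatterjee2021, §2.3 (centre transform)] -/
@[simp] theorem coe_centreTransformEquiv [MeasurableSpace G] [MeasurableMul G] (g₀ : G) :
    ⇑(centreTransformEquiv (d := d) g₀) = centreTransform g₀ := rfl

/-- Tilting commutes with the push-forward under a measurable map leaving the tilt function
invariant (change of variables in the density and in its normalisation). [folklore] -/
private theorem tilted_map_of_invariant {α : Type*} [MeasurableSpace α] (μ : Measure α) {τ : α → α}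
    (hτ : Measurable τ) {f : α → ℝ} (hf : Measurable f) (hinv : ∀ x, f (τ x) = f x) :
    (μ.tilted f).map τ = (μ.map τ).tilted f := by
  have hexp : Measurable fun x => Real.exp (f x) := Real.measurable_exp.comp hf
  have hC : ∫ x, Real.exp (f x) ∂(μ.map τ) = ∫ x, Real.exp (f x) ∂μ := by
    rw [integral_map hτ.aemeasurable hexp.aestronglyMeasurable]
    simp_rw [hinv]
  ext s hs
  have hdens : Measurable fun a => ENNReal.ofReal (Real.exp (f a) / ∫ x, Real.exp (f x) ∂μ) :=
    ENNReal.measurable_ofReal.comp (hexp.div_const _)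
  rw [Measure.map_apply hτ hs, Measure.tilted, Measure.tilted, withDensity_apply _ (hτ hs),
    withDensity_apply _ hs, hC, setLIntegral_map hs hdens hτ]
  simp_rw [hinv]

variable (ρ : G →* Matrix (Fin N) (Fin N) ℂ)
variable [TopologicalSpace G] [IsTopologicalGroup G] [CompactSpace G] [MeasurableSpace G]
  [BorelSpace G]

omit [TopologicalSpace G] [IsTopologicalGroup G] [CompactSpace G] [MeasurableSpace G] [BorelSpace G] in
/-- The centre transform intertwines the gluing maps: `τ (ζ η_{Λᶜ}) = (c ζ) (τ η)_{Λᶜ}` with the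
coordinate multiplier `c e ∈ {g₀, 1}` on `Λ`. [cite: Chatterjee2021, §2.3 (centre transform)] -/
theorem centreTransform_comp_glueWith (g₀ : G) (Λ : Finset (ZdEdge d)) (η : LGConfig d G) :
    (centreTransform g₀ ∘ fun ζ : ↥Λ → G => glueWith Λ ζ η) =
      (fun ζ : ↥Λ → G => glueWith Λ ζ (centreTransform g₀ η)) ∘
        fun ζ => (fun e : ↥Λ => if e.1.2 = 0 ∧ e.1.1 0 = 0 then g₀ else 1) * ζ := by
  funext ζ
  funext e
  simp only [Function.comp_apply, centreTransform_eq_mul]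
  by_cases he : e ∈ Λ
  · rw [glueWith_apply_mem _ _ _ he, glueWith_apply_mem _ _ _ he, Pi.mul_apply]
  · rw [glueWith_apply_not_mem _ _ _ he, glueWith_apply_not_mem _ _ _ he, centreTransform_eq_mul]

/-- **«τ is a symmetry of the specification α»** (Chatterjee 2021 §2.3: «Since `g₀` is an element
of the center of `G`, … the map `τ` leaves `ω_p` invariant for any plaquette `p`, and hence
(formally) leaves the Hamiltonian `H_{S,δ}` invariant. From this, it follows that `τ` is a symmetry
of the specification `α`»; Georgii 2011 §5.1): for continuous `ρ`, second-countable `G` and central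
`g₀`, the push-forward of the slab kernel with boundary condition `η` under the centre transform is
the slab kernel with boundary condition `τ η`, for EVERY finite edge set `Λ`. Proof: the tilt
`exp(−β S_Λ)` is `τ`-invariant (`wilsonBoundaryAction_centreTransform`), so tilting commutes with
`τ`; `τ` intertwines the gluing maps up to the coordinate multipliers `c ∈ {g₀,1}^Λ`
(`centreTransform_comp_glueWith`); and the product Haar measure is left-invariant under `c`.
[cite: Chatterjee2021, §2.3 (τ is a symmetry of the specification)] -/
theorem slabSpecification_map_centreTransform [SecondCountableTopology G] (hρ : Continuous ρ)
    {g₀ : G} (hg : g₀ ∈ Subgroup.center G) (β : ℝ) (n : ℕ) (Λ : Finset (ZdEdge d))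
    (η : LGConfig d G) :
    (slabSpecification ρ β n Λ η).map (centreTransform g₀) =
      slabSpecification ρ β n Λ (centreTransform g₀ η) := by
  unfold slabSpecification ymSpecification
  set Λ' : Finset (ZdEdge d) := Λ.filter (IsSlabInteriorEdge (d := d) n) with hΛ'
  have hτ : Measurable (centreTransform (d := d) g₀) := measurable_centreTransform g₀
  have hF : Measurable fun U : LGConfig d G => -β * wilsonBoundaryAction ρ Λ' U :=
    (continuous_const.mul (continuous_wilsonBoundaryAction ρ hρ Λ')).measurable
  have hinv : ∀ U : LGConfig d G,
      -β * wilsonBoundaryAction ρ Λ' (centreTransform g₀ U) = -β * wilsonBoundaryAction ρ Λ' U :=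
    fun U => by rw [wilsonBoundaryAction_centreTransform ρ hg]
  -- the product Haar measure on `G^{Λ'}` is left-invariant (Haar measure of the compact group `G`)
  haveI : Measure.IsMulLeftInvariant (QuantumFieldTheory.haarProbability G) := by
    unfold QuantumFieldTheory.haarProbability; infer_instance
  haveI : IsFiniteMeasure (QuantumFieldTheory.haarProbability G) := by
    unfold QuantumFieldTheory.haarProbability; infer_instance
  rw [tilted_map_of_invariant _ hτ hF hinv, Measure.map_map hτ (measurable_glueWith Λ' η),
    centreTransform_comp_glueWith g₀ Λ' η,
    ← Measure.map_map (measurable_glueWith Λ' (centreTransform g₀ η)) (measurable_const_mul _),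
    map_mul_left_eq_self]

/-- The centre transform maps DLR measures of the slab specification to DLR measures: if `μ`
satisfies the DLR equations for `slabSpecification ρ β n` then so does `τ_* μ` (change of variables
with the measurable automorphism `τ` and `slabSpecification_map_centreTransform`) (Georgii 2011
§5.1: a symmetry of a specification acts on its Gibbs measures). [cite: Georgii2011, §5.1 (symmetries act on 𝒢(γ))] -/
theorem IsGibbsMeasure.map_centreTransform [SecondCountableTopology G] (hρ : Continuous ρ)
    {g₀ : G} (hg : g₀ ∈ Subgroup.center G) {β : ℝ} {n : ℕ} {μ : Measure (LGConfig d G)}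
    (hμ : IsGibbsMeasure (slabSpecification ρ β n) μ) :
    IsGibbsMeasure (slabSpecification ρ β n) (μ.map (centreTransform g₀)) := by
  have hτ : Measurable (centreTransform (d := d) g₀) := measurable_centreTransform g₀
  haveI := hμ.1
  refine ⟨Measure.isProbabilityMeasure_map hτ.aemeasurable, fun Λ A hA => ?_⟩
  have h1 : ∫⁻ η, slabSpecification ρ β n Λ η A ∂μ.map (centreTransform g₀) =
      ∫⁻ η, slabSpecification ρ β n Λ (centreTransform g₀ η) A ∂μ := by
    rw [← coe_centreTransformEquiv, lintegral_map_equiv]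
  rw [h1]
  simp_rw [← slabSpecification_map_centreTransform ρ hρ hg β n Λ, Measure.map_apply hτ hA]
  rw [hμ.2 Λ _ (hτ hA)]

/-- For a slab of height `n ≥ 1` the centre transforms ACT on the Gibbs measures of the slab theory
with a given boundary condition `δ`: they only move interior (bottom vertical) links, so the
boundary condition is preserved, and they preserve the DLR equations
(`IsGibbsMeasure.map_centreTransform`). This is what Chatterjee's «every Gibbs measure of `α` is
invariant under the action of each center transform» presupposes. [cite: Chatterjee2021, §2.3 (τ is a symmetry of the specification)] -/
theorem map_centreTransform_mem_slabGibbsMeasures [SecondCountableTopology G] (hρ : Continuous ρ)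
    {g₀ : G} (hg : g₀ ∈ Subgroup.center G) {β : ℝ} {n : ℕ} (hn : 1 ≤ n) {δ : LGConfig d G}
    {μ : Measure (LGConfig d G)} (hμ : μ ∈ slabGibbsMeasures ρ β n δ) :
    μ.map (centreTransform g₀) ∈ slabGibbsMeasures ρ β n δ := by
  have hτ : Measurable (centreTransform (d := d) g₀) := measurable_centreTransform g₀
  refine ⟨IsGibbsMeasure.map_centreTransform ρ hρ hg hμ.1, ?_⟩
  rw [← coe_centreTransformEquiv, (centreTransformEquiv (d := d) g₀).measurableEmbedding.ae_map_iff,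
    coe_centreTransformEquiv]
  filter_upwards [hμ.2] with U hU e he
  have hne : ¬ (e.2 = 0 ∧ e.1 0 = 0) := fun h => he (isSlabInteriorEdge_of_bottom hn h)
  rw [centreTransform_apply_of_neg g₀ U hne]
  exact hU e he

end Symmetry

end Literature.MathematicalPhysics.QuantumLattice

end
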